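/-
Copyright (c) 2026 the pub-hodgecm-mathlib formalisation cell (harness21).  Prover seat hodgecm-mathlib-LH4-p11 (g8), req620 Track A «(D-RAM) FOUR-FRAME» squad, helper lane on
h413 = stmt-HodgeConjecture-24833 (count-neutral).  Dealer∕pen LH4-plan (g13) WORD #96 (2) «LH4-p11 OWNS THE PURE CELLS»; SIG-PureCells v1 (9a3f5135) §0∕§3, FILE 2a (the TOKEN form of ★ p860757).  2026-09-04.
-/
import Summits.HodgeConjecture.HodgeConjecture.Theorems.F0P3cDyRamLabelledOddOneSlotKappa        -- ★ p860757 (F0P3-p01 (g36)) B2b-1 PART 3: the one-slot labelled count is half a κ-count of the third slot; brings ★ p860467 HEAD C, ★ Fκ1∕Fκ2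
import Summits.HodgeConjecture.HodgeConjecture.Theorems.F0P3cDyRamDiagonalKappaSplitCountValues   -- ★ (LH4-p04): brings ★ `normSign_mul_norm`, ★ non-norm dichotomy `exists_nonnorm_dichotomy_of_isRamifiedQuadraticDatum`
import HarnessLib

/-!
# Crux `H413`, line LH4 «(D-RAM) FOUR-FRAME» — (β-BAL) Stage B, THE PURE CELLS, FILE 2a: ON A ONE-SLOT-DOMINANT LATTICE THE LABELLED ODD COUNT IS THE TOWER SIGN TIMES THE κ-COUNT
# `labelledOddCount σ ϖ 0 i Λ M ∕ [𝒰 : N(S̃′(M))] = ω(e_A)∕2 · (1, κ₂(M), κ₁(M))_i · stabiliserWeight σ M`  (slot `0` dominant; `(κ₂(M), 1, κ₀(M))_i` with `e_B` when slot `1` dominates)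

Cell `hodgecm-mathlib` (D-0151), FLOOR 0, crux item H413 = `stmt-HodgeConjecture-24833`, route `HCCMUnconditional`; squad F0∕P3c∕LH4.  THEOREMS ONLY (no `def`, no instance, no
notation, no `sorry`, default heartbeats); ★-only imports; lane `--supports stmt-HodgeConjecture-24833 --as helper` (count-neutral); pays NO row, states NO law.

THE MATHEMATICS (SIG-PureCells v1 §0∕§3).  ★ p860757 (F0P3-p01 (g36), B2b-1 PART 3) reads, on a normalised type-0 lattice `M = latt g` with base polarisation `D` whose slot-`1`
label term is `ϖ^{m*}`-small, `labelledOddCount_i ∕ [𝒰 : N S̃′] = ω(e′)·ω(D₀)∕2 · (1, κ₂(M), κ₁(M))_i · stabiliserWeight` for any σ-fixed unit `e′` with `D₀x₀ ≡ e′t₊`.  This file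
adds the TOKEN STEP that makes the sign ONE PER TOWER: with the tower-sign token `e_A` (`|(ϖ^{m*})⁻¹(x₀·π₀^{−j} − e_A t₊)| ≤ 1`, `π₀ = ϖσϖ`) and `|D₀·π₀^j| = 1` one may take
`e′ = D₀·π₀^j·e_A`, so `ω(e′)·ω(D₀) = ω(D₀)²·ω(N(ϖ^j))·ω(e_A) = ω(e_A)` (★ `normSign_mul_norm`, ★ multiplicativity on fixed units) — the per-lattice sign no longer sees the
polarisation.  Hence on every one-slot stratum the (β-BAL) labelled odd value is the TOWER SIGN `ω(e_X)∕2` times the ★ κ-socket of the complementary slot (FILE 2b: G₁).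
HONEST LABEL.  Count-neutral helper; the table identity (SIG-B2b3), (β-BAL), (β), T₊ remain OPEN; `HC_CM` is proved only modulo the 7 printed citations (2 remaining named inputs:
hLiu418 = `stmt-HodgeConjecture-24832`, h413 = `stmt-HodgeConjecture-24833`) until rung 0 closes.

## References
* [Kottwitz1986BaseChangeUnits] R. E. Kottwitz, *Base change for unit elements of Hecke algebras*, Compositio Math. 60 (1986), §1 pp. 240–241.
* [Rogawski1990] J. D. Rogawski, *Automorphic Representations of Unitary Groups in Three Variables*, Ann. of Math. Stud. 123 (1990), §4.9 Prop. 4.9.1 (a)(b) p. 55, §4.10 p. 58.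
* [LanglandsShelstad1987] R. P. Langlands, D. Shelstad, *On the definition of transfer factors*, Math. Ann. 278 (1987), §3.
* [Serre1979] J.-P. Serre, *Local Fields*, GTM 67 (1979), Ch. V §3 Cor. 3.
-/

set_option autoImplicit false

noncomputable section

namespace Summit.HodgeConjecture.HodgeConjecture.Cruxes.H413.F0P3cDyRamLabelledOddValueOfKappa

open Literature.NumberTheory.Automorphic Literature.NumberTheory.Automorphic.HermitianLattice
open Literature.NumberTheory.Automorphic.UnitaryLatticeTree Literature.NumberTheory.Automorphic.UnitaryThreeFourFrame
open Literature.NumberTheory.LocalFields Literature.NumberTheory.LocalFields.WildQuadraticDatum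
open Summit.HodgeConjecture.HodgeConjecture.Cruxes.H413.F0P3cDyRamDiagonalTorusDefs
open Summit.HodgeConjecture.HodgeConjecture.Cruxes.H413.F0P3cDyRamLabelledOddCountDefs
open Summit.HodgeConjecture.HodgeConjecture.Cruxes.H413.F0P3cDyRamDiagonalKappaCountDefs
open Summit.HodgeConjecture.HodgeConjecture.Cruxes.H413.F0P3cDyRamFixedCountDiagonalModel (normSign_mul_norm)
open Summit.HodgeConjecture.HodgeConjecture.Cruxes.H413.F0P3cDyRamDiagonalKappaSplitCountEval (normSign_mul_self)
open Summit.HodgeConjecture.HodgeConjecture.Cruxes.H413.F0P3cDyRamLabelledOddOneSlotKappa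
open scoped Valued WithZero Matrix MatrixGroups

variable {K : Type} [Field K] [Valued K ℤᵐ⁰] [CompleteSpace K] [Fintype 𝓀[K]] {σ : K →+* K} {ϖ : K} {d t : ℕ}

/-- **SLOT `0` DOMINANT: LABELLED ODD = `ω(e_A)∕2 · (1, κ₂, κ₁)_i · stabiliserWeight`.**  `M₀ = latt g` normalised, type `0` for `diag D₁` (`D₁` `σ`-fixed, non-zero), finite unit-torus
orbit, slot-`1` label term `ϖ^{m*}`-small, `|D₁0·π₀^j| = 1`, and the tower-sign token `e_A` at exponent `j`: for every slot `i`,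
`labelledOddCount σ ϖ 0 i (valueClassLabel σ ϖ x₀ x₁ m* d) M₀ ∕ [𝒰 : N(S̃′(M₀))] = ω(e_A)∕2 · (1, kappaCount σ ϖ 0 2 M₀, kappaCount σ ϖ 0 1 M₀)_i · stabiliserWeight σ M₀`
(★ p860757 with `e′ = D₁0·π₀^j·e_A`). [cite: Kottwitz1986BaseChangeUnits, §1 pp. 240–241] [cite: Rogawski1990, §4.9 Prop. 4.9.1 (a)(b) p. 55, §4.10 p. 58]
[cite: LanglandsShelstad1987, §3] [cite: Serre1979, Ch. V §3 Cor. 3] -/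
theorem labelledOddCount_div_relIndex_eq_normSign_mul_kappaCount_of_snd_small (hD : IsRamifiedQuadraticDatum σ ϖ d t)
    (x₀ x₁ : K) (g : GL (Fin 3) K) {M₀ : Submodule 𝒪[K] (Fin 3 → K)} (hM₀ : M₀ = latt (g : Matrix (Fin 3) (Fin 3) K)) (hnorm : IsNormalisedLattice M₀)
    (hfin : {M : Submodule 𝒪[K] (Fin 3 → K) | ∃ u ∈ unitTorus K 3, M = mapGL (diagGLUnits u) M₀}.Finite)
    {D₁ : Fin 3 → K} (hD₁ : ∀ j, σ (D₁ j) = D₁ j ∧ D₁ j ≠ 0) (hV₁ : IsVertexLattice σ ϖ (Matrix.diagonal D₁) 0 M₀)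
    (hsmall : ∀ y ∈ M₀, Valued.v ((ϖ ^ (d % 2 + 2 * d - 1))⁻¹ * (D₁ 1 * x₁ * (y 1 * σ (y 1)))) ≤ 1)
    (j : ℕ) (hvD0 : Valued.v (D₁ 0 * (ϖ * σ ϖ) ^ j) = 1)
    {eA : K} (hσeA : σ eA = eA) (heA1 : Valued.v eA = 1)
    (heA : Valued.v ((ϖ ^ (d % 2 + 2 * d - 1))⁻¹ * (x₀ * ((ϖ * σ ϖ) ^ j)⁻¹ - eA * ((ϖ - σ ϖ) * ((ϖ * σ ϖ) ^ ((d - d % 2) / 2))⁻¹))) ≤ 1) (i : Fin 3) :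
    (labelledOddCount σ ϖ 0 i (valueClassLabel σ ϖ x₀ x₁ (d % 2 + 2 * d - 1) d) M₀ : ℚ) /
        ((((unitStabilizer M₀).map (unitNormMap σ 3)).relIndex (fixedUnitTorus σ 3) : ℕ) : ℚ) =
      (normSign σ eA : ℚ) / 2 * (((![1, kappaCount σ ϖ 0 2 M₀, kappaCount σ ϖ 0 1 M₀] : Fin 3 → ℤ) i : ℤ) : ℚ) * stabiliserWeight σ M₀ := by
  have hD' := hD
  obtain ⟨hσ, hvσ, hϖ, -, -, -, -⟩ := hD'
  haveI : IsAdicComplete 𝓂[K] 𝒪[K] := isAdicComplete_valuedInteger_of_completeSpace hϖ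
  obtain ⟨c, hσc, hcv, hc, hdich⟩ := exists_nonnorm_dichotomy_of_isRamifiedQuadraticDatum σ ϖ d t hD
  have hϖ0 : ϖ ≠ 0 := fun h0 => by rw [h0, map_zero] at hϖ; exact WithZero.coe_ne_zero hϖ.symm
  have hσϖ0 : σ ϖ ≠ 0 := (map_ne_zero σ).2 hϖ0
  have hπ0 : ((ϖ * σ ϖ) ^ j : K) ≠ 0 := pow_ne_zero _ (mul_ne_zero hϖ0 hσϖ0)
  have hπσ : σ ((ϖ * σ ϖ) ^ j) = (ϖ * σ ϖ) ^ j := by rw [map_pow, map_mul, hσ, mul_comm]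
  have heA0 : eA ≠ 0 := fun h => by rw [h, map_zero] at heA1; exact zero_ne_one heA1
  have hD00 : D₁ 0 ≠ 0 := (hD₁ 0).2
  -- the head's `e′ = D₀·π₀^j·e_A`
  have hσe' : σ (D₁ 0 * (ϖ * σ ϖ) ^ j * eA) = D₁ 0 * (ϖ * σ ϖ) ^ j * eA := by rw [map_mul, map_mul, (hD₁ 0).1, hπσ, hσeA]
  have he'1 : Valued.v (D₁ 0 * (ϖ * σ ϖ) ^ j * eA) = 1 := by rw [map_mul, hvD0, heA1, one_mul]
  have hee : Valued.v ((ϖ ^ (d % 2 + 2 * d - 1))⁻¹ *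
      (D₁ 0 * x₀ - D₁ 0 * (ϖ * σ ϖ) ^ j * eA * ((ϖ - σ ϖ) * ((ϖ * σ ϖ) ^ ((d - d % 2) / 2))⁻¹))) ≤ 1 := by
    have e1 : (ϖ ^ (d % 2 + 2 * d - 1))⁻¹ * (D₁ 0 * x₀ - D₁ 0 * (ϖ * σ ϖ) ^ j * eA * ((ϖ - σ ϖ) * ((ϖ * σ ϖ) ^ ((d - d % 2) / 2))⁻¹)) =
        (D₁ 0 * (ϖ * σ ϖ) ^ j) * ((ϖ ^ (d % 2 + 2 * d - 1))⁻¹ * (x₀ * ((ϖ * σ ϖ) ^ j)⁻¹ - eA * ((ϖ - σ ϖ) * ((ϖ * σ ϖ) ^ ((d - d % 2) / 2))⁻¹))) := by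
      field_simp
    rw [e1, map_mul, hvD0, one_mul]
    exact heA
  -- `ω(e′)·ω(D₀) = ω(e_A)`
  have hωe' : normSign σ (D₁ 0 * (ϖ * σ ϖ) ^ j * eA) = normSign σ (D₁ 0) * normSign σ eA := by
    rw [show D₁ 0 * (ϖ * σ ϖ) ^ j * eA = (D₁ 0 * eA) * (ϖ ^ j * σ (ϖ ^ j)) by rw [map_pow, ← mul_pow]; ring, normSign_mul_norm σ _ (pow_ne_zero j hϖ0),
      normSign_mul_of_dichotomy σ hσc hc hdich (hD₁ 0).1 hσeA hD00 heA0]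
  have hωD0 : (normSign σ (D₁ 0) : ℚ) * (normSign σ (D₁ 0) : ℚ) = 1 := by exact_mod_cast normSign_mul_self σ (D₁ 0)
  have htok : (normSign σ (D₁ 0 * (ϖ * σ ϖ) ^ j * eA) : ℚ) * (normSign σ (D₁ 0) : ℚ) = normSign σ eA := by
    rw [hωe']; push_cast; linear_combination (normSign σ eA : ℚ) * hωD0
  by_cases hi0 : i = 0
  · subst hi0
    rw [labelledOddCount_valueClassLabel_div_relIndex_eq_of_snd_small_zero hD hσc hcv hc hdich x₀ x₁ g hM₀ hnorm hfin hD₁ hV₁ hsmall hσe' he'1 hee, htok]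
    simp only [Matrix.cons_val_zero]; push_cast; ring
  by_cases hi1 : i = 1
  · subst hi1
    rw [labelledOddCount_valueClassLabel_div_relIndex_eq_kappaCount_mul_of_snd_small hD hσc hcv hc hdich x₀ x₁ g hM₀ hnorm hfin hD₁ hV₁ hsmall hσe' he'1 hee
      (i := 1) (m := 2) (by decide) (by decide) (by decide), htok]
    simp only [Matrix.cons_val_one, Matrix.cons_val_zero]
  · obtain rfl : i = 2 := by
      fin_cases i
      · exact absurd rfl hi0
      · exact absurd rfl hi1
      · rfl
    rw [labelledOddCount_valueClassLabel_div_relIndex_eq_kappaCount_mul_of_snd_small hD hσc hcv hc hdich x₀ x₁ g hM₀ hnorm hfin hD₁ hV₁ hsmall hσe' he'1 hee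
      (i := 2) (m := 1) (by decide) (by decide) (by decide), htok]
    simp only [Matrix.cons_val_two, Matrix.tail_cons, Matrix.head_cons]

/-- **SLOT `1` DOMINANT: LABELLED ODD = `ω(e_B)∕2 · (κ₂, 1, κ₀)_i · stabiliserWeight`** — the symmetric read (slot-`0` label term `ϖ^{m*}`-small, `|D₁1·π₀^j| = 1`, token `e_B` on `x₁`;
★ p860757 `…_of_fst_small` ∕ `…_of_fst_small_one` with `e′ = D₁1·π₀^j·e_B`). [cite: Kottwitz1986BaseChangeUnits, §1 pp. 240–241] [cite: Rogawski1990, §4.9 Prop. 4.9.1 (a)(b) p. 55, §4.10 p. 58]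
[cite: LanglandsShelstad1987, §3] [cite: Serre1979, Ch. V §3 Cor. 3] -/
theorem labelledOddCount_div_relIndex_eq_normSign_mul_kappaCount_of_fst_small (hD : IsRamifiedQuadraticDatum σ ϖ d t)
    (x₀ x₁ : K) (g : GL (Fin 3) K) {M₀ : Submodule 𝒪[K] (Fin 3 → K)} (hM₀ : M₀ = latt (g : Matrix (Fin 3) (Fin 3) K)) (hnorm : IsNormalisedLattice M₀)
    (hfin : {M : Submodule 𝒪[K] (Fin 3 → K) | ∃ u ∈ unitTorus K 3, M = mapGL (diagGLUnits u) M₀}.Finite)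
    {D₁ : Fin 3 → K} (hD₁ : ∀ j, σ (D₁ j) = D₁ j ∧ D₁ j ≠ 0) (hV₁ : IsVertexLattice σ ϖ (Matrix.diagonal D₁) 0 M₀)
    (hsmall : ∀ y ∈ M₀, Valued.v ((ϖ ^ (d % 2 + 2 * d - 1))⁻¹ * (D₁ 0 * x₀ * (y 0 * σ (y 0)))) ≤ 1)
    (j : ℕ) (hvD1 : Valued.v (D₁ 1 * (ϖ * σ ϖ) ^ j) = 1)
    {eB : K} (hσeB : σ eB = eB) (heB1 : Valued.v eB = 1)
    (heB : Valued.v ((ϖ ^ (d % 2 + 2 * d - 1))⁻¹ * (x₁ * ((ϖ * σ ϖ) ^ j)⁻¹ - eB * ((ϖ - σ ϖ) * ((ϖ * σ ϖ) ^ ((d - d % 2) / 2))⁻¹))) ≤ 1) (i : Fin 3) :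
    (labelledOddCount σ ϖ 0 i (valueClassLabel σ ϖ x₀ x₁ (d % 2 + 2 * d - 1) d) M₀ : ℚ) /
        ((((unitStabilizer M₀).map (unitNormMap σ 3)).relIndex (fixedUnitTorus σ 3) : ℕ) : ℚ) =
      (normSign σ eB : ℚ) / 2 * (((![kappaCount σ ϖ 0 2 M₀, 1, kappaCount σ ϖ 0 0 M₀] : Fin 3 → ℤ) i : ℤ) : ℚ) * stabiliserWeight σ M₀ := by
  have hD' := hD
  obtain ⟨hσ, hvσ, hϖ, -, -, -, -⟩ := hD'
  haveI : IsAdicComplete 𝓂[K] 𝒪[K] := isAdicComplete_valuedInteger_of_completeSpace hϖ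
  obtain ⟨c, hσc, hcv, hc, hdich⟩ := exists_nonnorm_dichotomy_of_isRamifiedQuadraticDatum σ ϖ d t hD
  have hϖ0 : ϖ ≠ 0 := fun h0 => by rw [h0, map_zero] at hϖ; exact WithZero.coe_ne_zero hϖ.symm
  have hσϖ0 : σ ϖ ≠ 0 := (map_ne_zero σ).2 hϖ0
  have hπ0 : ((ϖ * σ ϖ) ^ j : K) ≠ 0 := pow_ne_zero _ (mul_ne_zero hϖ0 hσϖ0)
  have hπσ : σ ((ϖ * σ ϖ) ^ j) = (ϖ * σ ϖ) ^ j := by rw [map_pow, map_mul, hσ, mul_comm]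
  have heB0 : eB ≠ 0 := fun h => by rw [h, map_zero] at heB1; exact zero_ne_one heB1
  have hD10 : D₁ 1 ≠ 0 := (hD₁ 1).2
  have hσe' : σ (D₁ 1 * (ϖ * σ ϖ) ^ j * eB) = D₁ 1 * (ϖ * σ ϖ) ^ j * eB := by rw [map_mul, map_mul, (hD₁ 1).1, hπσ, hσeB]
  have he'1 : Valued.v (D₁ 1 * (ϖ * σ ϖ) ^ j * eB) = 1 := by rw [map_mul, hvD1, heB1, one_mul]
  have hee : Valued.v ((ϖ ^ (d % 2 + 2 * d - 1))⁻¹ *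
      (D₁ 1 * x₁ - D₁ 1 * (ϖ * σ ϖ) ^ j * eB * ((ϖ - σ ϖ) * ((ϖ * σ ϖ) ^ ((d - d % 2) / 2))⁻¹))) ≤ 1 := by
    have e1 : (ϖ ^ (d % 2 + 2 * d - 1))⁻¹ * (D₁ 1 * x₁ - D₁ 1 * (ϖ * σ ϖ) ^ j * eB * ((ϖ - σ ϖ) * ((ϖ * σ ϖ) ^ ((d - d % 2) / 2))⁻¹)) =
        (D₁ 1 * (ϖ * σ ϖ) ^ j) * ((ϖ ^ (d % 2 + 2 * d - 1))⁻¹ * (x₁ * ((ϖ * σ ϖ) ^ j)⁻¹ - eB * ((ϖ - σ ϖ) * ((ϖ * σ ϖ) ^ ((d - d % 2) / 2))⁻¹))) := by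
      field_simp
    rw [e1, map_mul, hvD1, one_mul]
    exact heB
  have hωe' : normSign σ (D₁ 1 * (ϖ * σ ϖ) ^ j * eB) = normSign σ (D₁ 1) * normSign σ eB := by
    rw [show D₁ 1 * (ϖ * σ ϖ) ^ j * eB = (D₁ 1 * eB) * (ϖ ^ j * σ (ϖ ^ j)) by rw [map_pow, ← mul_pow]; ring, normSign_mul_norm σ _ (pow_ne_zero j hϖ0),
      normSign_mul_of_dichotomy σ hσc hc hdich (hD₁ 1).1 hσeB hD10 heB0]
  have hωD1 : (normSign σ (D₁ 1) : ℚ) * (normSign σ (D₁ 1) : ℚ) = 1 := by exact_mod_cast normSign_mul_self σ (D₁ 1)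
  have htok : (normSign σ (D₁ 1 * (ϖ * σ ϖ) ^ j * eB) : ℚ) * (normSign σ (D₁ 1) : ℚ) = normSign σ eB := by
    rw [hωe']; push_cast; linear_combination (normSign σ eB : ℚ) * hωD1
  by_cases hi1 : i = 1
  · subst hi1
    rw [labelledOddCount_valueClassLabel_div_relIndex_eq_of_fst_small_one hD hσc hcv hc hdich x₀ x₁ g hM₀ hnorm hfin hD₁ hV₁ hsmall hσe' he'1 hee, htok]
    simp only [Matrix.cons_val_one, Matrix.cons_val_zero]; push_cast; ring
  by_cases hi0 : i = 0
  · subst hi0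
    rw [labelledOddCount_valueClassLabel_div_relIndex_eq_kappaCount_mul_of_fst_small hD hσc hcv hc hdich x₀ x₁ g hM₀ hnorm hfin hD₁ hV₁ hsmall hσe' he'1 hee
      (i := 0) (m := 2) (by decide) (by decide) (by decide), htok]
    simp only [Matrix.cons_val_zero]
  · obtain rfl : i = 2 := by
      fin_cases i
      · exact absurd rfl hi0
      · exact absurd rfl hi1
      · rfl
    rw [labelledOddCount_valueClassLabel_div_relIndex_eq_kappaCount_mul_of_fst_small hD hσc hcv hc hdich x₀ x₁ g hM₀ hnorm hfin hD₁ hV₁ hsmall hσe' he'1 hee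
      (i := 2) (m := 0) (by decide) (by decide) (by decide), htok]
    simp only [Matrix.cons_val_two, Matrix.tail_cons, Matrix.head_cons]

end Summit.HodgeConjecture.HodgeConjecture.Cruxes.H413.F0P3cDyRamLabelledOddValueOfKappa

end
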